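import Mathlib
import Summits.NavierStokesRegularity.NavierStokesRegularity.Theses.FilamentSkeletonRss
import Literature.Analysis.FluidPDE.PineauVicolRDSSLeray
import Summits.NavierStokesRegularity.NavierStokesRegularity.Theorems.FilamentSkeletonRssCoreGluingProfileSuffices
import Summits.NavierStokesRegularity.NavierStokesRegularity.Theorems.FilamentSkeletonRssCoreGluingPoincareMiranda

/-!
# Route FilamentSkeletonRss · crux `CoreGluing` (stmt-NavierStokesRegularity-15401) — line `zero-accretion-selection`, skeleton (reshape 2, lead c4)

`CoreGluing := SkeletonEquilibrium → RssProfileExists`.  Skeleton of line `zero-accretion-selection`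
(planner-cruxplan 2026-08-17; reshape 1 by lead a1 — windowed closeness; reshape 2 by lead c4 —
ball-exact tangency):

* `stub_selectionBox` — an `N`-parameter box `p ∈ [0,1]^N` of quantitative filament skeletons
  (unit speed, curvature `≤ K/√Γ`, proper, `ρ√Γ`-separated `C²` curves whose tangential material
  speed `w p j = ⟪v, X′⟫` has one supercritical zero with slope window `[3/2+δ, Λ]`, transverse
  Hurwitz confinement, non-degeneracy of the linearised tangency map modulo rotation about `e₃`, and
  which are EXACT relative equilibria of the regularised Biot–Savart law in the rotating Leray frame
  ON THE BALL `‖X p j τ‖ ≤ Rb √(Γ log Γ)`, with the stagnation points inside the closeness window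
  (`‖X p j (c p j)‖ ≤ Rw√Γ`, hence deep inside the ball for `Γ` large), linear escape
  `cg|τ − c| ≤ Rw√Γ + ‖X p j τ‖` and arclength-scale self-separation `cg ρ√Γ` outside the ball as inside — reshape 2: the sibling crux's exact-for-all-`τ` form is
  very probably false (Kelvin-sonic obstruction, Cruxes/SkeletonEquilibrium/Lines/Sketch-dead.md;
  negation line kelvin-sonic-negation) and its planners' (R-ball) re-cut is adopted here; the gluing
  only ever consumes the skeleton inside the closeness window `‖y‖ ≤ Rw√Γ ⊂` ball), continuous in
  `p`, such that EVERY continuous reduced family `(U, P, B)` solving the profile system modulo the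
  `N` accretion modes `D p j` has `B · j` of opposite strict signs on the faces `p_j = 0`, `p_j = 1`.
* `stub_transverseReduction` — for `Γ` large, every such skeleton box carries a continuous reduced
  family: smooth nontrivial divergence-free `U p` with Type-I envelope and bounded pressure solving
  the rotated Leray profile system up to `∑_j B p j • D p j`, `η√Γ`-close to the skeleton field off
  the `ρ√Γ/4`-tubes inside the window `‖y‖ ≤ Rw√Γ` (reshape 1, a1: un-windowed closeness contradicts
  the Type-I envelope along proper ends — `Theorems.stub_farFieldObstruction`, p139624).
* `stub_poincareMiranda` — Poincaré–Miranda on `[0,1]^N` (LANDED p139006, imported).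

`CoreGluing_of` composes them: selection box → reduced family → face signs → a zero `p*` of `B` →
an exact profile `U p*` → `RssProfileExists` by the landed `stub_rssProfileExists_of_profile` (p130189).
The hypothesis `SkeletonEquilibrium` is not consumed (if it is refuted — the sibling's negation line —
the crux holds vacuously: `Theorems.coreGluing_of_not_skeletonEquilibrium`).
-/

set_option linter.dupNamespace false

noncomputable section

namespace Summit.NavierStokesRegularity.NavierStokesRegularity.Theorems

open Set Function Filter MeasureTheory Real
open Literature.Analysis.FluidPDE Literature.Analysis.FluidPDE.PineauVicol2026
open scoped RealInnerProductSpace Laplacian ContDiff Topology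

/-- **Stub 1 (selection box).** Registered stub of crux stmt-NavierStokesRegularity-15401, line
`zero-accretion-selection` (reshape 2, lead c4: the relative-equilibrium identity is required only on the
ball `‖X p j τ‖ ≤ Rb √(Γ log Γ)` — the sibling crux's (R-ball) re-cut, Cruxes/SkeletonEquilibrium/Lines/Sketch-dead.md —
and `w p j` is the tangential material speed everywhere). -/
theorem stub_selectionBox :
    ∃ (N : ℕ) (δ ρ K Λ a b cnd η Rw Rb cg Γ₂ : ℝ), 0 < N ∧ 0 < δ ∧ 0 < ρ ∧ 0 < cnd ∧ 0 < η ∧ 0 < Rw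
    ∧ 0 < Rb ∧ 0 < cg ∧
    ∀ Γ : ℝ, Γ₂ ≤ Γ
    → ∃ (γ : (Fin N → ℝ) → Fin N → ℝ) (α : (Fin N → ℝ) → ℝ) (X : (Fin N → ℝ) → Fin N → ℝ →
    EuclideanSpace ℝ (Fin 3)) (w : (Fin N → ℝ) → Fin N → ℝ → ℝ) (c : (Fin N → ℝ) → Fin N → ℝ) (m n :
    (Fin N → ℝ) → Fin N → EuclideanSpace ℝ (Fin 3)), ∀ (u : (Fin N → ℝ) → (Fin N → ℝ →
    EuclideanSpace ℝ (Fin 3)) → EuclideanSpace ℝ (Fin 3) → EuclideanSpace ℝ (Fin 3)) (v : (Fin N →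
    ℝ) → EuclideanSpace ℝ (Fin 3) → EuclideanSpace ℝ (Fin 3)) (A : (Fin N → ℝ) → Fin N →
    (EuclideanSpace ℝ (Fin 3) →L[ℝ] EuclideanSpace ℝ (Fin 3))) (T : (Fin N → ℝ) → (Fin N → ℝ →
    EuclideanSpace ℝ (Fin 3)) → Fin N → ℝ → EuclideanSpace ℝ (Fin 3)) (D : (Fin N → ℝ) → Fin N →
    EuclideanSpace ℝ (Fin 3) → EuclideanSpace ℝ (Fin 3)), (∀ p Z y, u p Z y = ∑ k : Fin N, (Γ * γ p
    k / (4 * π)) • ∫ σ : ℝ, ((‖y - Z k σ‖ ^ 2 + 1) ^ (3 / 2 : ℝ))⁻¹ • cross (deriv (Z k) σ) (y - Z k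
    σ)) → (∀ p y, v p y = u p (X p) y + (1 / 2 : ℝ) • y - α p • rotGen y) → (∀ p j, A p j = fderiv ℝ
    (v p) (X p j (c p j))) → (∀ p Z j τ, T p Z j τ = (u p Z (Z j τ) + (1 / 2 : ℝ) • Z j τ - α p •
    rotGen (Z j τ)) - (inner ℝ (u p Z (Z j τ) + (1 / 2 : ℝ) • Z j τ - α p • rotGen (Z j τ)) (deriv
    (Z j) τ) / ‖deriv (Z j) τ‖ ^ 2) • deriv (Z j) τ) → (∀ p j y, D p j y = (Real.exp (-(inner ℝ (y -
    X p j (c p j)) (deriv (X p j) (c p j))) ^ 2) * ((1 - Real.exp (-(‖y - X p j (c p j)‖ ^ 2 - inner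
    ℝ (y - X p j (c p j)) (deriv (X p j) (c p j)) ^ 2))) / (‖y - X p j (c p j)‖ ^ 2 - inner ℝ (y - X
    p j (c p j)) (deriv (X p j) (c p j)) ^ 2))) • cross (deriv (X p j) (c p j)) (y - X p j (c p j)))
    → ((∀ j, ContinuousOn (fun q : (Fin N → ℝ) × ℝ => (α q.1, γ q.1 j, X q.1 j q.2, w q.1 j q.2))
    ({p : Fin N → ℝ | ∀ i, p i ∈ Icc (0:ℝ) 1} ×ˢ univ)) ∧ (∀ p : Fin N → ℝ, (∀ i, p i ∈ Icc (0:ℝ) 1)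
    → α p ≠ 0 ∧ (∀ j, γ p j ≠ 0) ∧ (∀ j, ContDiff ℝ 2 (X p j) ∧ Differentiable ℝ (w p j) ∧ (∀ τ,
    ‖deriv (X p j) τ‖ = 1) ∧ (∀ τ, ‖iteratedDeriv 2 (X p j) τ‖ * Real.sqrt Γ ≤ K) ∧ Tendsto (fun τ
    => ‖X p j τ‖) (cocompact ℝ) atTop) ∧ (∀ j k, j ≠ k → ∀ τ σ, ρ * Real.sqrt Γ ≤ ‖X p j τ - X p k
    σ‖) ∧ (∀ j τ σ, ρ * Real.sqrt Γ ≤ |τ - σ| → cg * ρ * Real.sqrt Γ ≤ ‖X p j τ - X p j σ‖) ∧ (∀ j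
    τ, cg * |τ - c p j| ≤ Rw * Real.sqrt Γ + ‖X p j τ‖) ∧ (∀ j τ, w p j τ = inner ℝ (v p (X p j τ))
    (deriv (X p j) τ)) ∧ (∀ j τ, ‖X p j τ‖ ≤ Rb *
    Real.sqrt (Γ * Real.log Γ) → v p (X p j τ) = w p j τ • deriv (X p j) τ) ∧ (∀ j, ‖X p j (c p j)‖
    ≤ Rw * Real.sqrt Γ) ∧ (∀ j, w p j (c p j) = 0 ∧ (∀ τ, w p j
    τ = 0 → τ = c p j) ∧ 3 / 2 + δ ≤ deriv (w p j) (c p j) ∧ deriv (w p j) (c p j) ≤ Λ) ∧ (∀ j,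
    Orthonormal ℝ ![deriv (X p j) (c p j), m p j, n p j] ∧ inner ℝ (A p j (m p j)) (m p j) + inner ℝ
    (A p j (n p j)) (n p j) < 0 ∧ inner ℝ (A p j (n p j)) (m p j) * inner ℝ (A p j (m p j)) (n p j)
    < inner ℝ (A p j (m p j)) (m p j) * inner ℝ (A p j (n p j)) (n p j)) ∧ (∀ Y : Fin N → ℝ →
    EuclideanSpace ℝ (Fin 3), (∀ j, ContDiff ℝ 2 (Y j)) → (∀ j τ, inner ℝ (Y j τ) (deriv (X p j) τ)
    = 0) → ∑ j : Fin N, inner ℝ (Y j (c p j)) (rotGen (X p j (c p j))) = 0 → (∀ j τ, ‖Y j τ‖ +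
    ‖deriv (Y j) τ‖ + ‖iteratedDeriv 2 (Y j) τ‖ ≤ (1 + |τ - c p j|) ^ b) → ∀ L : ℝ, (∀ j τ, ‖deriv
    (fun s : ℝ => T p (fun k σ => X p k σ + s • Y k σ) j τ) 0‖ ≤ L * (1 + |τ - c p j|) ^ a) → ∀ j τ,
    ‖Y j τ‖ ≤ cnd * L * (1 + |τ - c p j|) ^ b))) ∧ (∀ (C₀ M : ℝ) (U : (Fin N → ℝ) → EuclideanSpace ℝ
    (Fin 3) → EuclideanSpace ℝ (Fin 3)) (P : (Fin N → ℝ) → EuclideanSpace ℝ (Fin 3) → ℝ) (B : (Fin N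
    → ℝ) → Fin N → ℝ), (ContinuousOn B {p : Fin N → ℝ | ∀ i, p i ∈ Icc (0:ℝ) 1} ∧ ∀ p : Fin N → ℝ,
    (∀ i, p i ∈ Icc (0:ℝ) 1) → U p ≠ 0 ∧ ContDiff ℝ (⊤ : ℕ∞) (U p) ∧ ContDiff ℝ (⊤ : ℕ∞) (P p) ∧
    VectorCalculus.IsDivFree (U p) ∧ (∀ y, α p • (rotGen (U p y) - fderiv ℝ (U p) y (rotGen y)) + (1
    / 2 : ℝ) • U p y + (1 / 2 : ℝ) • fderiv ℝ (U p) y y - (Δ (U p)) y + fderiv ℝ (U p) y (U p y) +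
    gradient (P p) y = ∑ j : Fin N, B p j • D p j y) ∧ (∀ y, ‖U p y‖ ≤ C₀ / (1 + ‖y‖)) ∧ (∀ y, |P p
    y| ≤ M) ∧ (∀ y, ‖y‖ ≤ Rw * Real.sqrt Γ → (∀ j τ, ρ * Real.sqrt Γ / 4 ≤ ‖y - X p j τ‖) →
    ‖U p y - u p (X p) y‖ ≤ η *
    Real.sqrt Γ)) → (∀ (j : Fin N) (p q : Fin N → ℝ), (∀ i, p i ∈ Icc (0:ℝ) 1) → (∀ i, q i ∈ Icc
    (0:ℝ) 1) → p j = 0 → q j = 1 → B p j * B q j < 0)) := by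
  sorry

/-- **Stub 2 (transverse reduction modulo the accretion modes).** Registered stub of crux
stmt-NavierStokesRegularity-15401, line `zero-accretion-selection` (reshape 2, lead c4: accepts ball-exact skeletons,
parameter `Rb`; the closeness window `‖y‖ ≤ Rw√Γ` lies inside the ball for `Γ` large). -/
theorem stub_transverseReduction :
    ∀ (N : ℕ) (δ ρ K Λ a b cnd η Rw Rb cg : ℝ), 0 < N → 0 < δ → 0 < ρ → 0 < η → 0 < Rw → 0 < Rb → 0
    < cg → ∃ Γ₁ : ℝ, ∀ Γ : ℝ,
    Γ₁ ≤ Γ → ∀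
    (γ : (Fin N → ℝ) → Fin N → ℝ) (α : (Fin N → ℝ) → ℝ) (X : (Fin N → ℝ) → Fin N → ℝ →
    EuclideanSpace ℝ (Fin 3)) (w : (Fin N → ℝ) → Fin N → ℝ → ℝ) (c : (Fin N → ℝ) → Fin N → ℝ) (m n :
    (Fin N → ℝ) → Fin N → EuclideanSpace ℝ (Fin 3)) (u : (Fin N → ℝ) → (Fin N → ℝ → EuclideanSpace ℝ
    (Fin 3)) → EuclideanSpace ℝ (Fin 3) → EuclideanSpace ℝ (Fin 3)) (v : (Fin N → ℝ) →
    EuclideanSpace ℝ (Fin 3) → EuclideanSpace ℝ (Fin 3)) (A : (Fin N → ℝ) → Fin N → (EuclideanSpace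
    ℝ (Fin 3) →L[ℝ] EuclideanSpace ℝ (Fin 3))) (T : (Fin N → ℝ) → (Fin N → ℝ → EuclideanSpace ℝ (Fin
    3)) → Fin N → ℝ → EuclideanSpace ℝ (Fin 3)) (D : (Fin N → ℝ) → Fin N → EuclideanSpace ℝ (Fin 3)
    → EuclideanSpace ℝ (Fin 3)), (∀ p Z y, u p Z y = ∑ k : Fin N, (Γ * γ p k / (4 * π)) • ∫ σ : ℝ,
    ((‖y - Z k σ‖ ^ 2 + 1) ^ (3 / 2 : ℝ))⁻¹ • cross (deriv (Z k) σ) (y - Z k σ)) → (∀ p y, v p y = u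
    p (X p) y + (1 / 2 : ℝ) • y - α p • rotGen y) → (∀ p j, A p j = fderiv ℝ (v p) (X p j (c p j)))
    → (∀ p Z j τ, T p Z j τ = (u p Z (Z j τ) + (1 / 2 : ℝ) • Z j τ - α p • rotGen (Z j τ)) - (inner
    ℝ (u p Z (Z j τ) + (1 / 2 : ℝ) • Z j τ - α p • rotGen (Z j τ)) (deriv (Z j) τ) / ‖deriv (Z j) τ‖
    ^ 2) • deriv (Z j) τ) → (∀ p j y, D p j y = (Real.exp (-(inner ℝ (y - X p j (c p j)) (deriv (X p
    j) (c p j))) ^ 2) * ((1 - Real.exp (-(‖y - X p j (c p j)‖ ^ 2 - inner ℝ (y - X p j (c p j))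
    (deriv (X p j) (c p j)) ^ 2))) / (‖y - X p j (c p j)‖ ^ 2 - inner ℝ (y - X p j (c p j)) (deriv
    (X p j) (c p j)) ^ 2))) • cross (deriv (X p j) (c p j)) (y - X p j (c p j))) → ((∀ j,
    ContinuousOn (fun q : (Fin N → ℝ) × ℝ => (α q.1, γ q.1 j, X q.1 j q.2, w q.1 j q.2)) ({p : Fin N
    → ℝ | ∀ i, p i ∈ Icc (0:ℝ) 1} ×ˢ univ)) ∧ (∀ p : Fin N → ℝ, (∀ i, p i ∈ Icc (0:ℝ) 1) → α p ≠ 0 ∧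
    (∀ j, γ p j ≠ 0) ∧ (∀ j, ContDiff ℝ 2 (X p j) ∧ Differentiable ℝ (w p j) ∧ (∀ τ, ‖deriv (X p j)
    τ‖ = 1) ∧ (∀ τ, ‖iteratedDeriv 2 (X p j) τ‖ * Real.sqrt Γ ≤ K) ∧ Tendsto (fun τ => ‖X p j τ‖)
    (cocompact ℝ) atTop) ∧ (∀ j k, j ≠ k → ∀ τ σ, ρ * Real.sqrt Γ ≤ ‖X p j τ - X p k σ‖) ∧ (∀ j τ σ,
    ρ * Real.sqrt Γ ≤ |τ - σ| → cg * ρ * Real.sqrt Γ ≤ ‖X p j τ - X p j σ‖) ∧ (∀ j τ, cg * |τ - c p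
    j| ≤ Rw * Real.sqrt Γ + ‖X p j τ‖) ∧ (∀ j τ, w
    p j τ = inner ℝ (v p (X p j τ)) (deriv (X p j) τ)) ∧ (∀ j τ, ‖X p j τ‖ ≤ Rb * Real.sqrt (Γ *
    Real.log Γ) → v p (X p j τ) = w p j τ • deriv (X p j) τ) ∧ (∀ j, ‖X p j (c p j)‖ ≤ Rw *
    Real.sqrt Γ) ∧ (∀ j, w p j (c p j) = 0 ∧ (∀ τ, w p j
    τ = 0 → τ = c p
    j) ∧ 3 / 2 + δ ≤ deriv (w p j) (c p j) ∧ deriv (w p j) (c p j) ≤ Λ) ∧ (∀ j, Orthonormal ℝ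
    ![deriv (X p j) (c p j), m p j, n p j] ∧ inner ℝ (A p j (m p j)) (m p j) + inner ℝ (A p j (n p
    j)) (n p j) < 0 ∧ inner ℝ (A p j (n p j)) (m p j) * inner ℝ (A p j (m p j)) (n p j) < inner ℝ (A
    p j (m p j)) (m p j) * inner ℝ (A p j (n p j)) (n p j)) ∧ (∀ Y : Fin N → ℝ → EuclideanSpace ℝ
    (Fin 3), (∀ j, ContDiff ℝ 2 (Y j)) → (∀ j τ, inner ℝ (Y j τ) (deriv (X p j) τ) = 0) → ∑ j : Fin
    N, inner ℝ (Y j (c p j)) (rotGen (X p j (c p j))) = 0 → (∀ j τ, ‖Y j τ‖ + ‖deriv (Y j) τ‖ +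
    ‖iteratedDeriv 2 (Y j) τ‖ ≤ (1 + |τ - c p j|) ^ b) → ∀ L : ℝ, (∀ j τ, ‖deriv (fun s : ℝ => T p
    (fun k σ => X p k σ + s • Y k σ) j τ) 0‖ ≤ L * (1 + |τ - c p j|) ^ a) → ∀ j τ, ‖Y j τ‖ ≤ cnd * L
    * (1 + |τ - c p j|) ^ b))) → ∃ (C₀ M : ℝ) (U : (Fin N → ℝ) → EuclideanSpace ℝ (Fin 3) →
    EuclideanSpace ℝ (Fin 3)) (P : (Fin N → ℝ) → EuclideanSpace ℝ (Fin 3) → ℝ) (B : (Fin N → ℝ) →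
    Fin N → ℝ), (ContinuousOn B {p : Fin N → ℝ | ∀ i, p i ∈ Icc (0:ℝ) 1} ∧ ∀ p : Fin N → ℝ, (∀ i, p
    i ∈ Icc (0:ℝ) 1) → U p ≠ 0 ∧ ContDiff ℝ (⊤ : ℕ∞) (U p) ∧ ContDiff ℝ (⊤ : ℕ∞) (P p) ∧
    VectorCalculus.IsDivFree (U p) ∧ (∀ y, α p • (rotGen (U p y) - fderiv ℝ (U p) y (rotGen y)) + (1
    / 2 : ℝ) • U p y + (1 / 2 : ℝ) • fderiv ℝ (U p) y y - (Δ (U p)) y + fderiv ℝ (U p) y (U p y) +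
    gradient (P p) y = ∑ j : Fin N, B p j • D p j y) ∧ (∀ y, ‖U p y‖ ≤ C₀ / (1 + ‖y‖)) ∧ (∀ y, |P p
    y| ≤ M) ∧ (∀ y, ‖y‖ ≤ Rw * Real.sqrt Γ → (∀ j τ, ρ * Real.sqrt Γ / 4 ≤ ‖y - X p j τ‖) →
    ‖U p y - u p (X p) y‖ ≤ η *
    Real.sqrt Γ)) := by
  sorry

/-- **Composition.** `CoreGluing` from the three stubs (the hypothesis `SkeletonEquilibrium` is not consumed:
the line re-derives its own quantitative skeleton box). -/
theorem CoreGluing_of :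
    Summit.NavierStokesRegularity.NavierStokesRegularity.Theses.FilamentSkeletonRss.CoreGluing := by
  intro _hK1
  classical
  obtain ⟨N, δ, ρ, K, Λ, a, b, cnd, η, Rw, Rb, cg, Γ₂, hN, hδ, hρ, _hcnd, hη, hRw, hRb, hcg, hbox⟩ := stub_selectionBox
  obtain ⟨Γ₁, hred⟩ := stub_transverseReduction N δ ρ K Λ a b cnd η Rw Rb cg hN hδ hρ hη hRw hRb hcg
  obtain ⟨γ, α, X, w, c, m, n, hfam⟩ := hbox (max Γ₁ Γ₂) (le_max_right _ _)
  -- the derived objects of the skeleton box at circulation `Γ = max Γ₁ Γ₂`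
  set Γ : ℝ := max Γ₁ Γ₂ with hΓ
  set u : (Fin N → ℝ) → (Fin N → ℝ → EuclideanSpace ℝ (Fin 3)) → EuclideanSpace ℝ (Fin 3) →
      EuclideanSpace ℝ (Fin 3) := fun p Z y => ∑ k : Fin N, (Γ * γ p k / (4 * π)) • ∫ σ : ℝ,
        ((‖y - Z k σ‖ ^ 2 + 1) ^ (3 / 2 : ℝ))⁻¹ • cross (deriv (Z k) σ) (y - Z k σ) with hu
  set v : (Fin N → ℝ) → EuclideanSpace ℝ (Fin 3) → EuclideanSpace ℝ (Fin 3) :=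
    fun p y => u p (X p) y + (1 / 2 : ℝ) • y - α p • rotGen y with hv
  set A : (Fin N → ℝ) → Fin N → (EuclideanSpace ℝ (Fin 3) →L[ℝ] EuclideanSpace ℝ (Fin 3)) :=
    fun p j => fderiv ℝ (v p) (X p j (c p j)) with hA
  set T : (Fin N → ℝ) → (Fin N → ℝ → EuclideanSpace ℝ (Fin 3)) → Fin N → ℝ →
      EuclideanSpace ℝ (Fin 3) :=
    fun p Z j τ => (u p Z (Z j τ) + (1 / 2 : ℝ) • Z j τ - α p • rotGen (Z j τ)) -
      (inner ℝ (u p Z (Z j τ) + (1 / 2 : ℝ) • Z j τ - α p • rotGen (Z j τ)) (deriv (Z j) τ) /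
        ‖deriv (Z j) τ‖ ^ 2) • deriv (Z j) τ with hT
  set D : (Fin N → ℝ) → Fin N → EuclideanSpace ℝ (Fin 3) → EuclideanSpace ℝ (Fin 3) :=
    fun p j y => (Real.exp (-(inner ℝ (y - X p j (c p j)) (deriv (X p j) (c p j))) ^ 2) *
      ((1 - Real.exp (-(‖y - X p j (c p j)‖ ^ 2 -
        inner ℝ (y - X p j (c p j)) (deriv (X p j) (c p j)) ^ 2))) /
        (‖y - X p j (c p j)‖ ^ 2 - inner ℝ (y - X p j (c p j)) (deriv (X p j) (c p j)) ^ 2))) •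
      cross (deriv (X p j) (c p j)) (y - X p j (c p j)) with hD
  obtain ⟨⟨hcont, hskel⟩, hsign⟩ := hfam u v A T D (fun _ _ _ => rfl) (fun _ _ => rfl)
    (fun _ _ => rfl) (fun _ _ _ _ => rfl) (fun _ _ _ => rfl)
  obtain ⟨C₀, M, U, P, B, hUPB⟩ := hred Γ (le_max_left _ _) γ α X w c m n u v A T D
    (fun _ _ _ => rfl) (fun _ _ => rfl) (fun _ _ => rfl) (fun _ _ _ _ => rfl) (fun _ _ _ => rfl)
    ⟨hcont, hskel⟩
  have hs := hsign C₀ M U P B hUPB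
  obtain ⟨hBcont, hfamU⟩ := hUPB
  -- the corner `(1,…,1)` and the face points `(1,…,0,…,1)`
  set one : Fin N → ℝ := fun _ => 1 with hone
  have hone_mem : ∀ i, one i ∈ Icc (0:ℝ) 1 := fun _ => ⟨zero_le_one, le_rfl⟩
  have hupd_mem : ∀ j i, Function.update one j 0 i ∈ Icc (0:ℝ) 1 := by
    intro j i
    rcases eq_or_ne i j with rfl | h
    · simp
    · rw [Function.update_of_ne h]; exact hone_mem i
  -- `B one j ≠ 0`, and the signs on the two faces
  have hface0 : ∀ j (p : Fin N → ℝ), (∀ i, p i ∈ Icc (0:ℝ) 1) → p j = 0 → B p j * B one j < 0 :=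
    fun j p hp hpj => hs j p one hp hone_mem hpj rfl
  have hone_ne : ∀ j, B one j ≠ 0 := by
    intro j h0
    have := hface0 j (Function.update one j 0) (hupd_mem j) (by simp)
    rw [h0, mul_zero] at this
    exact lt_irrefl _ this
  have hface1 : ∀ j (q : Fin N → ℝ), (∀ i, q i ∈ Icc (0:ℝ) 1) → q j = 1 → 0 < B one j * B q j := by
    intro j q hq hqj
    have h1 : B (Function.update one j 0) j * B q j < 0 :=
      hs j (Function.update one j 0) q (hupd_mem j) hq (by simp) hqj
    have h2 : B (Function.update one j 0) j * B one j < 0 :=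
      hface0 j (Function.update one j 0) (hupd_mem j) (by simp)
    rcases mul_neg_iff.1 h1 with ⟨ha, hb⟩ | ⟨ha, hb⟩
    · rcases mul_neg_iff.1 h2 with ⟨_, hb'⟩ | ⟨ha', _⟩
      · exact mul_pos_of_neg_of_neg hb' hb
      · exact absurd ha (not_lt.2 ha'.le)
    · rcases mul_neg_iff.1 h2 with ⟨ha', _⟩ | ⟨_, hb'⟩
      · exact absurd ha (not_lt.2 ha'.le)
      · exact mul_pos hb' hb
  -- the sign-normalised accretion map and Poincaré–Miranda
  set f : (Fin N → ℝ) → Fin N → ℝ := fun p j => B one j * B p j with hf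
  have hfcont : ContinuousOn f {p : Fin N → ℝ | ∀ i, p i ∈ Icc (0:ℝ) 1} :=
    continuousOn_pi.2 fun j => continuousOn_const.mul ((continuousOn_pi.1 hBcont) j)
  obtain ⟨ps, hps, hzero⟩ := stub_poincareMiranda N f hfcont
    (fun p hp j hpj => by
      have := hface0 j p hp hpj
      show B one j * B p j ≤ 0
      rw [mul_comm]; exact this.le)
    (fun q hq j hqj => (hface1 j q hq hqj).le)
  have hB0 : ∀ j, B ps j = 0 := fun j =>
    (mul_eq_zero.1 (hzero j)).resolve_left (hone_ne j)
  -- the selected member of the reduced family is an exact profile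
  obtain ⟨hU0, hUs, hPs, hdiv, heq, hdec, hPM, -⟩ := hfamU ps hps
  have heq0 : ∀ y : EuclideanSpace ℝ (Fin 3), α ps • (rotGen (U ps y) - fderiv ℝ (U ps) y (rotGen y)) +
      (1 / 2 : ℝ) • U ps y + (1 / 2 : ℝ) • fderiv ℝ (U ps) y y - (Δ (U ps)) y +
      fderiv ℝ (U ps) y (U ps y) + gradient (P ps) y = 0 := by
    intro y
    rw [heq y]
    simp [hB0]
  exact stub_rssProfileExists_of_profile
    ⟨α ps, C₀, M, U ps, P ps, (hskel ps hps).1, hU0, hUs, hPs, hdiv, heq0, hdec, hPM⟩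

end Summit.NavierStokesRegularity.NavierStokesRegularity.Theorems
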